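import Mathlib
import HarnessLib

/-!
# Crux `LogCanQuotLU` (stmt-ResolutionOfSingularities-17082), line `birth`:
# stub `stub_constantsFG` — the constants of a finitely generated model are finitely generated

Route `ResolutionOfSingularities/FoliationDescent`, crux #3 `LogCanQuotLU` (local uniformization of
the field of constants `K^D` of a `k`-derivation `D` along a valuation). This file proves the
bookkeeping first stub of the line `birth` (`Cruxes/LogCanQuotLU/Lines/birth.lean`,
`Sig.stub_constantsFG`, verbatim): for `k` a field of characteristic `p`, `S' ≤ K` a finitely
generated `k`-subalgebra with `Frac S' = K` and `D` ANY `k`-derivation of `K`, the ring of constants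
`S'^D := {x ∈ S' | D x = 0}` is (the carrier of) a finitely generated `k`-subalgebra `A`, and every
`D`-constant of `K` is a quotient of two elements of `A` (so `Frac A = K^D`).

Proof (standard, e.g. the finiteness of `S'` over `k[S'^p]`):
* `A` is a `k`-subalgebra by the Leibniz rule, and `K` has characteristic `p`, so
  `D (x ^ p) = p • x ^ (p - 1) • D x = 0`: `p`-th powers are constants.
* Write `S' = k[s]` for a finite `s`, and let `B₀ := k[x ^ p | x ∈ s] ≤ A ≤ S'`. Then `B₀` is
  Noetherian (a finitely generated algebra over a field) and `S' = B₀[s]` is a finitely generated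
  `B₀`-module, each `x ∈ s` being integral over `B₀` (`x ^ p ∈ B₀`). Hence the `B₀`-submodule `A`
  of `S'` is finitely generated, say by `t`, and `A = k[s ^ p ∪ t]` is a finitely generated
  `k`-algebra.
* If `D x = 0` and `x = a / b` with `a, b ∈ S'`, `b ≠ 0` (`Frac S' = K`), then
  `x = (a b ^ (p - 1)) / b ^ p` with `b ^ p ∈ A` and `a b ^ (p - 1) = x b ^ p ∈ S' ∩ ker D`.

No perfectness of `k` and no hypothesis on `D` (non-zero, `p`-closed, …) is needed.

Main result: `stub_constantsFG` (registered signature of the line, verbatim). The two helper facts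
(`exists_subalgebra_mem_iff_mem_and_apply_eq_zero`, `derivation_apply_pow_eq_zero`,
`fg_of_mem_iff_mem_and_apply_eq_zero`) live in the sub-namespace `ConstantsFG`.
-/

set_option linter.dupNamespace false -- single-problem summit: doubled namespace component is forced

noncomputable section

namespace Summit.ResolutionOfSingularities.ResolutionOfSingularities.Theorems

namespace ConstantsFG

/-- The constants of a `k`-derivation `D` of `K` lying in a `k`-subalgebra `S'` form a
`k`-subalgebra `S' ∩ ker D` of `K` (Leibniz rule; `D` kills `k`). Stated as an existence with a
membership characterization, which is all the stub needs. [folklore] -/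
theorem exists_subalgebra_mem_iff_mem_and_apply_eq_zero {k K : Type} [Field k] [Field K]
    [Algebra k K] (S' : Subalgebra k K) (D : Derivation k K K) :
    ∃ A : Subalgebra k K, ∀ x : K, x ∈ A ↔ (x ∈ S' ∧ D x = 0) := by
  refine ⟨{ carrier := {x | x ∈ S' ∧ D x = 0}
            mul_mem' := ?_
            one_mem' := ⟨S'.one_mem, by simp⟩
            add_mem' := ?_
            zero_mem' := ⟨S'.zero_mem, by simp⟩
            algebraMap_mem' := fun c => ⟨S'.algebraMap_mem c, D.map_algebraMap c⟩ },
          fun x => Iff.rfl⟩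
  · rintro a b ⟨ha, hDa⟩ ⟨hb, hDb⟩
    refine ⟨S'.mul_mem ha hb, ?_⟩
    rw [D.leibniz, hDa, hDb, smul_zero, smul_zero, add_zero]
  · rintro a b ⟨ha, hDa⟩ ⟨hb, hDb⟩
    refine ⟨S'.add_mem ha hb, ?_⟩
    rw [map_add, hDa, hDb, add_zero]

/-- In characteristic `p`, `p`-th powers are constants of every derivation:
`D (x ^ p) = p • x ^ (p - 1) • D x = 0`. [folklore] -/
theorem derivation_apply_pow_eq_zero {k K : Type} [Field k] [Field K] [Algebra k K] (p : ℕ)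
    [CharP K p] (D : Derivation k K K) (x : K) : D (x ^ p) = 0 := by
  rw [D.leibniz_pow x p, nsmul_eq_mul, CharP.cast_eq_zero, zero_mul]

/-- **Finite generation of the ring of constants.** If `S' = k[s]` is a finitely generated
`k`-subalgebra of a field `K` of characteristic `p` and `D` is a `k`-derivation of `K`, then the
`k`-subalgebra `A = S' ∩ ker D` is finitely generated: `B₀ := k[s ^ p] ≤ A ≤ S' = B₀[s]`, `S'` is a
finitely generated module over the Noetherian ring `B₀` (each generator has its `p`-th power in
`B₀`), so the `B₀`-submodule `A` is finitely generated, by `t` say, and `A = k[s ^ p ∪ t]`.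
[folklore] -/
theorem fg_of_mem_iff_mem_and_apply_eq_zero {k K : Type} [Field k] [Field K] [Algebra k K]
    {p : ℕ} (hp : p.Prime) [CharP K p] (S' : Subalgebra k K) (D : Derivation k K K)
    (hS'fg : S'.FG) (A : Subalgebra k K) (hA : ∀ x : K, x ∈ A ↔ (x ∈ S' ∧ D x = 0)) :
    A.FG := by
  classical
  have hDp : ∀ x : K, D (x ^ p) = 0 := derivation_apply_pow_eq_zero p D
  obtain ⟨s, hs⟩ := hS'fg
  have hsS' : ∀ x ∈ s, x ∈ S' := fun x hx => by
    rw [← hs]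
    exact Algebra.subset_adjoin (Finset.mem_coe.mpr hx)
  -- the `p`-th powers of the generators, and `B₀ := k[s ^ p]`
  obtain ⟨sp, hsp, hsp'⟩ : ∃ sp : Finset K, (∀ y ∈ sp, ∃ x ∈ s, x ^ p = y) ∧
      ∀ x ∈ s, x ^ p ∈ sp :=
    ⟨s.image fun x : K => x ^ p, fun y hy => by simpa using hy,
      fun x hx => Finset.mem_image_of_mem _ hx⟩
  have hspA : (sp : Set K) ⊆ (A : Set K) := by
    intro y hy
    obtain ⟨x, hx, rfl⟩ := hsp y (Finset.mem_coe.mp hy)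
    exact (hA _).mpr ⟨S'.pow_mem (hsS' x hx) p, hDp x⟩
  have hB₀A : Algebra.adjoin k (sp : Set K) ≤ A := Algebra.adjoin_le hspA
  haveI hB₀noeth : IsNoetherianRing (Algebra.adjoin k (sp : Set K)) :=
    isNoetherianRing_of_fg (Subalgebra.fg_adjoin_finset _)
  -- every generator is integral over `B₀` (its `p`-th power lies in `B₀`)
  have hint : ∀ x ∈ (s : Set K), IsIntegral (Algebra.adjoin k (sp : Set K)) x := by
    intro x hx
    have hxp : x ^ p ∈ Algebra.adjoin k (sp : Set K) :=
      Algebra.subset_adjoin (Finset.mem_coe.mpr (hsp' x (Finset.mem_coe.mp hx)))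
    have h1 : IsIntegral (Algebra.adjoin k (sp : Set K))
        (algebraMap (Algebra.adjoin k (sp : Set K)) K ⟨x ^ p, hxp⟩) :=
      isIntegral_algebraMap
    exact IsIntegral.of_pow hp.pos h1
  -- so `S' = B₀[s]` is a finitely generated `B₀`-module
  have hMfg : (Subalgebra.toSubmodule
      (Algebra.adjoin (Algebra.adjoin k (sp : Set K)) (s : Set K))).FG :=
    fg_adjoin_of_finite s.finite_toSet hint
  -- `A` as a `B₀`-submodule of `K` (closed under `B₀` because `B₀ ≤ A`)
  obtain ⟨N, hN⟩ :
      ∃ N : Submodule (Algebra.adjoin k (sp : Set K)) K, ∀ x : K, x ∈ N ↔ x ∈ A :=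
    ⟨{ carrier := A
       add_mem' := fun ha hb => A.add_mem ha hb
       zero_mem' := A.zero_mem
       smul_mem' := fun c x hx => A.mul_mem (hB₀A c.2) hx }, fun x => Iff.rfl⟩
  have hNM : N ≤ Subalgebra.toSubmodule
      (Algebra.adjoin (Algebra.adjoin k (sp : Set K)) (s : Set K)) := by
    intro x hx
    have hxS' : x ∈ Algebra.adjoin k (s : Set K) := by
      rw [hs]
      exact ((hA x).mp ((hN x).mp hx)).1
    have hle : Algebra.adjoin k (s : Set K) ≤
        (Algebra.adjoin (Algebra.adjoin k (sp : Set K)) (s : Set K)).restrictScalars k := by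
      refine Algebra.adjoin_le fun y hy => ?_
      rw [SetLike.mem_coe, Subalgebra.mem_restrictScalars]
      exact Algebra.subset_adjoin hy
    rw [Subalgebra.mem_toSubmodule]
    exact (Subalgebra.mem_restrictScalars k).mp (hle hxS')
  have hNfg : N.FG :=
    isNoetherian_submodule.mp (isNoetherian_of_fg_of_noetherian _ hMfg) N hNM
  obtain ⟨t, ht⟩ := hNfg
  -- `A = k[s ^ p ∪ t]`
  refine ⟨sp ∪ t, le_antisymm ?_ ?_⟩
  · refine Algebra.adjoin_le ?_
    rw [Finset.coe_union]
    refine Set.union_subset hspA ?_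
    intro y hy
    have hyN : y ∈ N := by
      rw [← ht]
      exact Submodule.subset_span hy
    exact (hN y).mp hyN
  · intro x hx
    have hxN : x ∈ Submodule.span (Algebra.adjoin k (sp : Set K)) (t : Set K) := by
      rw [ht]
      exact (hN x).mpr hx
    clear hx
    induction hxN using Submodule.span_induction with
    | mem y hy =>
      exact Algebra.subset_adjoin (by rw [Finset.coe_union]; exact Or.inr hy)
    | zero => exact Subalgebra.zero_mem _
    | add y z _ _ hy hz => exact Subalgebra.add_mem _ hy hz
    | smul c y _ hy =>
      have hc : (c : K) ∈ Algebra.adjoin k ((sp ∪ t : Finset K) : Set K) :=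
        Algebra.adjoin_mono (by rw [Finset.coe_union]; exact Set.subset_union_left) c.2
      exact Subalgebra.mul_mem _ hc hy

end ConstantsFG

open ConstantsFG in
/-- **The ring of constants of a finitely generated model is a finitely generated model of the
field of constants** (stub `stub_constantsFG` of line `birth` of the crux `LogCanQuotLU`,
registered signature verbatim): for `k` a field of characteristic `p`, `S' ≤ K` a finitely
generated `k`-subalgebra with `Frac S' = K` and `D` any `k`-derivation of `K`, there is a
`k`-subalgebra `A` of `K` with carrier `S'^D = {x ∈ S' | D x = 0}`, finitely generated, such that
every `D`-constant `x` of `K` is a quotient `a / b` of elements of `A` with `b ≠ 0` (namely, if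
`x = a / b` with `a, b ∈ S'`, then `x = (a b ^ (p-1)) / b ^ p`). No perfectness of `k` and no
hypothesis on `D` is used. [folklore] -/
theorem stub_constantsFG :
  ∀ p : ℕ, p.Prime → ∀ (k K : Type) [Field k] [CharP k p] [Field K] [Algebra k K]
    (S' : Subalgebra k K) (D : Derivation k K K), S'.FG → IsFractionRing S' K →
    ∃ A : Subalgebra k K, (∀ x : K, x ∈ A ↔ (x ∈ S' ∧ D x = 0)) ∧ A.FG ∧
      (∀ x : K, D x = 0 → ∃ a b : K, a ∈ A ∧ b ∈ A ∧ b ≠ 0 ∧ x = a / b) := by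
  intro p hp k K _ _ _ _ S' D hS'fg hS'frac
  haveI : CharP K p := charP_of_injective_algebraMap (algebraMap k K).injective p
  have hDp : ∀ x : K, D (x ^ p) = 0 := derivation_apply_pow_eq_zero p D
  obtain ⟨A, hA⟩ := exists_subalgebra_mem_iff_mem_and_apply_eq_zero S' D
  refine ⟨A, hA, fg_of_mem_iff_mem_and_apply_eq_zero hp S' D hS'fg A hA, ?_⟩
  intro x hx
  haveI := hS'frac
  obtain ⟨a, b, -, hab⟩ := IsFractionRing.div_surjective (A := S') x
  have hx' : x = (a : K) / (b : K) := by rw [← hab]; rfl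
  by_cases hb0 : (b : K) = 0
  · refine ⟨0, 1, A.zero_mem, A.one_mem, one_ne_zero, ?_⟩
    rw [hx', hb0, div_zero, zero_div]
  obtain ⟨n, hn⟩ : ∃ n : ℕ, p = n + 1 := Nat.exists_eq_succ_of_ne_zero hp.ne_zero
  -- `x = (a b ^ n) / b ^ (n + 1)`
  have key : x * (b : K) ^ p = a * b ^ n := by
    rw [hx', hn, pow_succ]
    field_simp
  refine ⟨(a : K) * b ^ n, (b : K) ^ p, ?_, ?_, pow_ne_zero _ hb0, ?_⟩
  · refine (hA _).mpr ⟨S'.mul_mem a.2 (S'.pow_mem b.2 n), ?_⟩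
    rw [← key, D.leibniz, hDp, hx, smul_zero, smul_zero, add_zero]
  · exact (hA _).mpr ⟨S'.pow_mem b.2 p, hDp _⟩
  · rw [eq_div_iff (pow_ne_zero _ hb0), key]

end Summit.ResolutionOfSingularities.ResolutionOfSingularities.Theorems

end
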